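import Literature.IUT.HodgeArakelov.GoodPrimeKummerBridgeHolds
import Literature.IUT.HodgeArakelov.ConstantMonoidRealification
import Literature.AnabelianGeometry.AbsoluteAnabelian.MLFGaloisUnitsFunctors
import HarnessLib

/-!
# [IUTchII] Prop 4.2 (ii) at good nonarchimedean primes, last clauses: the natural poly-isomorphism
# `Ψ^ss_{†F^⊢_v} ⥲ Ψ^ss_cns(†G_v)` of mono-analytic semi-simplifications, CONSTRUCTED with its members listed

S. Mochizuki, *Inter-universal Teichmüller theory II*, §4, kurims manuscript (Dec. 2020), Proposition 4.2 (ii)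
p. 124 (`v ∈ V^good ∩ V^non`), read on the page (lit key `paper:url-5036b4059555`, p. 124) [cite: Mochizuki2012,
Prop 4.2 (ii) p.124]. Claim key DISPUTED (D-0012). Printed (p. 124): "there exists a unique `†G_v`-equivariant
`Ẑ^×`-orbit of isomorphisms of topological groups `Ψ^×_{†F^⊢_v} ⥲ Ψ_cns(†G_v)^×` as well as a unique isomorphism of
monoids `Ψ^R_{†F^⊢_v} := (Ψ_{†F^⊢_v}/Ψ^×_{†F^⊢_v})^rlf ⥲ Ψ^R_cns(†G_v)` that maps the distinguished element of `Ψ^R_{†F^⊢_v}`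
determined by the unique generator of `Ψ_{†F^⊢_v}/Ψ^×_{†F^⊢_v}` to the distinguished element of `Ψ^R_cns(†G_v)` determined
by `log^{†G_v}(p_v) ∈ R_{≥0}(†G_v)` … In particular, we obtain a natural poly-isomorphism of ind-topological monoids
`Ψ^ss_{†F^⊢_v} := Ψ^×_{†F^⊢_v} × Ψ^R_{†F^⊢_v} ⥲ Ψ^ss_cns(†G_v)` … that is compatible with the natural splittings on the domain and
codomain. Let `Ψ^ss_{†F_v} := Ψ^×_{†F_v} × Ψ^R_{†F_v}` denote the ind-topological monoid determined, via the natural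
isomorphism `F^{⊢×}_v ⥲ F^{⊢×}_{⟨v⟩}` … by `Ψ^ss_{†F^⊢_v}`; thus, we have a natural isomorphism [i.e., as opposed to a
poly-isomorphism!] `Ψ^ss_{†F_v} ⥲ Ψ^ss_{†F^⊢_v}`." Printed proof (p. 125): "follow immediately from the definitions".

INPUTS (in the tree). The `Ẑ^×`-orbit: this seat's `Prop42iiUnit` / `prop42iiUnit_of_monoAnalytic` (p415949 +
`GoodPrimeKummerBridgeHolds.lean`: for `TCG`-pairs of mono-analytic type the `f`-equivariant isomorphisms of unit
groups form ONE torsor under `Aut(μ_Ẑ) = Ẑ^×`, unconditionally); the realified isomorphism: abc-iut-L6-t2's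
`PsiRlf Ψ = (Ψ/Ψ^×)^rlf`, `PsiRlf.toNNReal` / `PsiRlf.eq_toNNReal` (the UNIQUE isomorphism `(Ψ/Ψ^×)^rlf ⥲ ℝ_{≥0}` carrying
the class of `p_v` to `log(p_v)`, `ConstantMonoidRealification.lean`) and `SemiSimplifiedRlf Ψ = Ψ^× × Ψ^R`; the
unit pair `(Π ↷ M^×)` of a `TM`-pair: abc-iut-L4-t2's `GaloisMonoidPair.unitsPair`; `Ψ^ss_cns(†G_v) = Ψ_cns(†G_v)^× ×
R_{≥0}(†G_v)` with `R_{≥0}(†G_v) = ℝ≥0 ∋ log(p_v)` (abc-iut-L6-t2's normalisation `LogRealDatum`).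

WHAT THE KERNEL IS MADE TO SAY, for `TM`-pairs `P = (†G_v ↷ Ψ_{†F^⊢_v})`, `Q = (†G_v ↷ Ψ_cns(†G_v))` and an
identification `f` of the acting groups: `semiSimplifiedPolyIsoNonarch P Q f h hp D` = the set of isomorphisms
`Ψ^×_{†F^⊢_v} × Ψ^R_{†F^⊢_v} ⥲ Ψ_cns(†G_v)^× × R_{≥0}(†G_v)` of the form (an `f`-equivariant isomorphism of the unit groups) ×
(an isomorphism of realified parts with the printed normalisation); PROVED: its realified component is
ALWAYS abc-iut-L6-t2's normalised `PsiRlf.toNNReal` (`mem_semiSimplifiedPolyIsoNonarch_iff`), it is compatible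
with the splittings (`…_unit`, `…_realified`), and for pairs whose unit pairs are of mono-analytic type it is
EXACTLY ONE `Ẑ^×`-torsor: for every automorphism datum `u` of the cyclotomes there is exactly one member whose
unit component induces `u` (`existsUnique_mem_semiSimplifiedPolyIsoNonarch`). The "natural isomorphism
`Ψ^ss_{†F_v} ⥲ Ψ^ss_{†F^⊢_v}`" is, in this encoding (`Ψ^ss_{†F_v}` DEFINED as the semi-simplification of the same
monoid), the identity — no declaration. Companion at `v ∈ V^arc`: `GoodPrimeKummerBridgeArchSemiSimplified.lean`.

HONEST FRAMING. Products of isomorphisms already in the tree; nothing here bears on [IUTchIII] Cor. 3.12 or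
takes a side; typed ≠ discharged elsewhere.
-/

noncomputable section

open scoped _root_.NNReal

namespace Literature.IUT.HodgeArakelov

open Literature.AnabelianGeometry.AbsoluteAnabelian
open Literature.AlgebraicGeometry.Frobenioids

namespace GoodPrimeKummer

variable (P Q : GaloisMonoidPair.{0}) (f : P.Pi ≃ₜ* Q.Pi)
variable (h : IsMonoprime (Associates P.M)) {p : P.M} (hp : ¬ IsUnit p) (D : LogRealDatum)

/-- **The natural poly-isomorphism `Ψ^ss_{†F^⊢_v} := Ψ^×_{†F^⊢_v} × Ψ^R_{†F^⊢_v} ⥲ Ψ^ss_cns(†G_v)` of [IUTchII] Prop 4.2 (ii)**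
(p. 124), for `TM`-pairs `P = (†G_v ↷ Ψ_{†F^⊢_v})`, `Q = (†G_v ↷ Ψ_cns(†G_v))`, an identification `f` of the groups, the
divisor-monoid hypothesis `Ψ/Ψ^×` monoprime with the non-unit `p = p_v`, and `R_{≥0}(†G_v) ∋ log(p_v)` (`D`): the
isomorphisms `φ × ρ : Ψ^× × (Ψ/Ψ^×)^rlf ⥲ Ψ_cns^× × R_{≥0}` with `φ` an `f`-equivariant isomorphism of unit groups (a member
of the `Ẑ^×`-orbit of the first display) and `ρ` carrying the class of `p_v` to `log(p_v)`.
[cite: Mochizuki2012, Prop 4.2 (ii) p.124] -/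
def semiSimplifiedPolyIsoNonarch : Set (SemiSimplifiedRlf P.M ≃* Q.Mˣ × Multiplicative ℝ≥0) :=
  {e | ∃ (φ : P.Mˣ ≃* Q.Mˣ) (ρ : PsiRlf P.M ≃* Multiplicative ℝ≥0),
    φ ∈ equivariantIsoOver P.unitsPair Q.unitsPair f ∧
      ρ (PsiRlf.logp p) = Multiplicative.ofAdd D.logp ∧ e = MulEquiv.prodCongr φ ρ}

/-- The member with unit component `φ`: `φ × ρ₀`, `ρ₀` THE normalised realified isomorphism
(abc-iut-L6-t2's `PsiRlf.toNNReal`). [cite: Mochizuki2012, Prop 4.2 (ii) p.124] -/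
def semiSimplifiedIsoNonarch (φ : P.Mˣ ≃* Q.Mˣ) : SemiSimplifiedRlf P.M ≃* Q.Mˣ × Multiplicative ℝ≥0 :=
  MulEquiv.prodCongr φ (PsiRlf.toNNReal h hp D)

/-- **Membership, PROVED**: an isomorphism belongs to the poly-isomorphism iff it is `φ × ρ₀` for an
`f`-equivariant isomorphism `φ` of unit groups and THE normalised realified isomorphism `ρ₀` (the realified
component is unique, abc-iut-L6-t2's `PsiRlf.eq_toNNReal`). [cite: Mochizuki2012, Prop 4.2 (ii) p.124] -/
theorem mem_semiSimplifiedPolyIsoNonarch_iff (e : SemiSimplifiedRlf P.M ≃* Q.Mˣ × Multiplicative ℝ≥0) :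
    e ∈ semiSimplifiedPolyIsoNonarch P Q f (p := p) D ↔
      ∃ φ : P.Mˣ ≃* Q.Mˣ, φ ∈ equivariantIsoOver P.unitsPair Q.unitsPair f ∧
        e = semiSimplifiedIsoNonarch P Q h hp D φ := by
  constructor
  · rintro ⟨φ, ρ, hφ, hρ, rfl⟩
    exact ⟨φ, hφ, by rw [PsiRlf.eq_toNNReal h hp D ρ hρ]; rfl⟩
  · rintro ⟨φ, hφ, rfl⟩
    exact ⟨φ, PsiRlf.toNNReal h hp D, hφ, PsiRlf.toNNReal_logp h hp D, rfl⟩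

/-- "compatible with the natural splittings on the domain and codomain" — unit factor: a member carries
`Ψ^× × {0}` to `Ψ_cns^× × {0}` by its (equivariant) unit component. [cite: Mochizuki2012, Prop 4.2 (ii) p.124] -/
theorem semiSimplifiedPolyIsoNonarch_unit {e : SemiSimplifiedRlf P.M ≃* Q.Mˣ × Multiplicative ℝ≥0}
    (he : e ∈ semiSimplifiedPolyIsoNonarch P Q f (p := p) D) :
    ∃ φ : P.Mˣ ≃* Q.Mˣ, φ ∈ equivariantIsoOver P.unitsPair Q.unitsPair f ∧ ∀ u : P.Mˣ, e (u, 1) = (φ u, 1) := by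
  obtain ⟨φ, ρ, hφ, -, rfl⟩ := he
  exact ⟨φ, hφ, fun u => Prod.ext rfl (map_one ρ)⟩

/-- … realified factor: a member carries `{1} × Ψ^R` to `{1} × R_{≥0}` by THE normalised realified isomorphism,
in particular the class of `p_v` to `log(p_v)`. [cite: Mochizuki2012, Prop 4.2 (ii) p.124] -/
theorem semiSimplifiedPolyIsoNonarch_realified {e : SemiSimplifiedRlf P.M ≃* Q.Mˣ × Multiplicative ℝ≥0}
    (he : e ∈ semiSimplifiedPolyIsoNonarch P Q f (p := p) D) (r : PsiRlf P.M) :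
    e (1, r) = (1, PsiRlf.toNNReal h hp D r) := by
  obtain ⟨φ, ρ, -, hρ, rfl⟩ := he
  rw [PsiRlf.eq_toNNReal h hp D ρ hρ]
  exact Prod.ext (map_one φ) rfl

/-- The distinguished elements correspond under every member: `(1, [p_v]) ↦ (1, log(p_v))`.
[cite: Mochizuki2012, Prop 4.2 (ii) p.124] -/
theorem semiSimplifiedPolyIsoNonarch_logp {e : SemiSimplifiedRlf P.M ≃* Q.Mˣ × Multiplicative ℝ≥0}
    (he : e ∈ semiSimplifiedPolyIsoNonarch P Q f (p := p) D) :
    e (1, PsiRlf.logp p) = (1, Multiplicative.ofAdd D.logp) := by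
  obtain ⟨φ, ρ, -, hρ, rfl⟩ := he
  exact Prod.ext (map_one φ) hρ

/-- **The poly-isomorphism is EXACTLY ONE `Ẑ^×`-torsor** ("a unique `†G_v`-equivariant `Ẑ^×`-orbit", p. 124): if the
unit pairs `(†G_v ↷ Ψ^×_{†F^⊢_v})`, `(†G_v ↷ Ψ_cns(†G_v)^×)` are `TCG`-pairs of mono-analytic type (the printed situation:
both acted on by isomorphs of `†G_v` itself), then for every isomorphism `u` of their cyclotomes there is EXACTLY
ONE member of the poly-isomorphism whose unit component induces `u` — from the unconditional
`prop42iiUnit_of_monoAnalytic` (`GoodPrimeKummerBridgeHolds.lean`) and the uniqueness of the realified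
component. [cite: Mochizuki2012, Prop 4.2 (ii) p.124] -/
theorem existsUnique_mem_semiSimplifiedPolyIsoNonarch
    (hPm : IsOfMonoAnalyticTypeMonoid .TCG P.unitsPair) (hQm : IsOfMonoAnalyticTypeMonoid .TCG Q.unitsPair)
    (u : cyclotome P.unitsPair.M ≃* cyclotome Q.unitsPair.M) :
    ∃! e : SemiSimplifiedRlf P.M ≃* Q.Mˣ × Multiplicative ℝ≥0,
      ∃ φ : P.Mˣ ≃* Q.Mˣ, φ ∈ equivariantIsoOver P.unitsPair Q.unitsPair f ∧
        (∀ ζ, cyclotomeMapOf (P := P.unitsPair) (Q := Q.unitsPair) φ ζ = u ζ) ∧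
        e = semiSimplifiedIsoNonarch P Q h hp D φ := by
  obtain ⟨φ, ⟨hφ, hu⟩, huniq⟩ := prop42iiUnit_of_monoAnalytic (P := P.unitsPair) (Q := Q.unitsPair) hPm hQm f u
  refine ⟨semiSimplifiedIsoNonarch P Q h hp D φ, ⟨φ, hφ, hu, rfl⟩, ?_⟩
  rintro e ⟨φ', hφ', hu', rfl⟩
  rw [huniq φ' ⟨hφ', hu'⟩]

/-- Every member determined by a cyclotome datum lies in the poly-isomorphism (the torsor is INSIDE the
printed poly-isomorphism). [cite: Mochizuki2012, Prop 4.2 (ii) p.124] -/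
theorem semiSimplifiedIsoNonarch_mem {φ : P.Mˣ ≃* Q.Mˣ}
    (hφ : φ ∈ equivariantIsoOver P.unitsPair Q.unitsPair f) :
    semiSimplifiedIsoNonarch P Q h hp D φ ∈ semiSimplifiedPolyIsoNonarch P Q f (p := p) D :=
  (mem_semiSimplifiedPolyIsoNonarch_iff P Q f h hp D _).2 ⟨φ, hφ, rfl⟩

end GoodPrimeKummer

end Literature.IUT.HodgeArakelov

end
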